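/-
Copyright (c) 2026 the pub-hodgecm-mathlib formalisation cell (harness21).  Prover seat hodgecm-mathlib-K2Liu-p11 (g3), Track B «K2-LIT»,
#184♮ = hLiu418 = `stmt-HodgeConjecture-24832`; #41 G6-arch (A∞) general `K_w`-type, piece (H2-an) FILE 3: THE SWAP LEMMA FOR EVERY `K_w`-FINITE SIEGEL SECTION
(the binders `hD₁ ∕ hD₂` of ★ (H2-alg) `K2LiuArchIntertwiningKTypeLadder.rung_step` on ALL rungs).
THEOREMS ONLY (no `def`, no `instance`, no notation, no named-fact hypothesis, no `sorry`).
-/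
import Summits.HodgeConjecture.HodgeConjecture.Theorems.K2LiuArchIntertwiningDominatedSwap    -- ★ (H2-an) FILE 1 p861447 (the dominated swap for a majorised pair)
import Summits.HodgeConjecture.HodgeConjecture.Theorems.K2LiuArchKFiniteSectionMajorised       -- ★∕📤 (H2-an) FILE 2 p861501 (continuity + majoration of sections with a compact picture)
import Summits.HodgeConjecture.HodgeConjecture.Theorems.K2LiuArchIntertwiningLieDerivativeExp  -- ★ (A) sequel (`hasDerivAt_exp_smul_entry_at`; brings `continuous_of_entry_hasDerivAt`)
import HarnessLib

/-!
# Crux `HLiu418`, G6-arch (A∞), (H2-an) FILE 3: `M_w(s)` COMMUTES WITH THE RIGHT LIE DERIVATIVE ALONG `exp(tX)`, `X ∈ 𝔲(J)`, ON EVERY SECTION OF `I_w(s, χ_k)`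
# WITH A COMPACT PICTURE IN `𝒜 = ℂ[u, D⁻¹]` (`re s > ½`)

Cell `hodgecm-mathlib`, crux item hLiu418 = `stmt-HodgeConjecture-24832` (helper lane `--supports`, count-neutral); squad K2 ∕ K2Liu, prover K2Liu-p11 (g3).

DATA: `k : ℤ`, `s : ℂ`, `χ_k(z) = (z̄∕‖z‖)^k`, `F ∈ I_w(s, χ_k)` (★ `IsArchSiegelSection`) with compact picture `Q ∈ 𝒜` (`F(k_v) = ev_v Q`), `X ∈ 𝔲(J)`; the RIGHT RAY DERIVATIVE
`D_X F := y ↦ d∕dt|₀ F(y·exp(tX))` (written `fun y => deriv (fun t => F (y * exp (t • X))) 0`, no definition introduced).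
* §1 `isArchSiegelSection_rayDeriv` — `D_X F ∈ I_w(s, χ_k)` again (the Siegel law commutes with right translations); `differentiableAt_ray` — `t ↦ F(y·exp(tX))` is
  differentiable at `0` for EVERY `y ∈ U(J)` as soon as it is at every `k_v` (rational Iwasawa `y = p_y · k_{v(y)}`, ★ S2-P A); `hasDerivAt_ray` — hence
  `HasDerivAt (t ↦ F(y·exp(tX))) ((D_X F)(y·exp(t₀X))) t₀` (★ FILE 1's binder `hFD`, `γ_t = exp(tX) ∈ U(J)` ★ `conjTranspose_exp_mul_J_mul_exp`).
* §2 for `X = C·(α β; γ δ)·C′` real (★ FILE 1′ `hasDerivAt_section_kU_exp_evalAt'`): differentiability at every `k_u` and **the compact picture of `D_X F` is `Op^{(k,s)}_{(αβγδ)} Q`**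
  (`rayDeriv_kU_eq_evalAt_op`).
* §3 **`integrable_and_hasDerivAt_archIntertwining_rayDeriv`** — THE SWAP: for `re s > ½`, `g ∈ U(J)`,
  **`HasDerivAt (t ↦ M_w F (g·exp(tX))) (M_w (D_X F) (g)) 0`** and `r ↦ (D_X F)(J n(hermOfReal r) g)` is integrable — ★ FILE 1 with the binders of ★ FILE 2 (for `F` AND for `D_X F`,
  itself a section with compact picture `Op Q`) and §1.  At `g = k_u` this is EXACTLY ★ `rung_step`'s `hD_j` with `G := M_w F` read as `fun y => archIntertwining F y`,
  `D_j := fun y => archIntertwining (D_{X_j} F) y`; the linearity letter `hlin` is then `M_w(D_{X₁}F) + i·M_w(D_{X₂}F) = a·M_w(F₁)` (linearity of the integral on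
  the pointwise identity `D_{X₁}F + i D_{X₂}F = a F₁` on `U(J)`, ★ `eq_of_apply_kU_eq`).
References: [Knapp1986, Ch. VII §§3–4, Ch. VIII §3]; [Shimura1997, §16.4]; [LeeZhu1998, §5 p. 5032].
HONEST LABEL: HC_CM is proved only modulo the 7 printed citations (2 remaining named inputs: hLiu418 = stmt-HodgeConjecture-24832,
h413 = stmt-HodgeConjecture-24833) until rung 0 closes; count-neutral helper, closes no socket.
-/

set_option autoImplicit false
set_option linter.dupNamespace false

noncomputable section

open Complex Matrix MeasureTheory Filter NormedSpace
open scoped ComplexConjugate ComplexOrder Topology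

namespace Summit.HodgeConjecture.HodgeConjecture.Cruxes.HLiu418.K2LiuArchIntertwiningKFiniteSwap

open Literature.NumberTheory.ModularForms.SiegelUpperHalfSpace (num denom num_def denom_def)
open Summit.HodgeConjecture.HodgeConjecture.Cruxes.HLiu418.K2LiuHermitianTubeCocycle (mul_mem_UJ isUnit_det_denom posDef_im_I_smul_one)
open Summit.HodgeConjecture.HodgeConjecture.Cruxes.HLiu418.K2LiuArchInducedTubeDefs
open Summit.HodgeConjecture.HodgeConjecture.Cruxes.HLiu418.K2LiuU22ShilovCoordinate
open Summit.HodgeConjecture.HodgeConjecture.Cruxes.HLiu418.K2LiuU22CompactPictureDefs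
open Summit.HodgeConjecture.HodgeConjecture.Cruxes.HLiu418.K2LiuU22CompactPictureOperatorDictionary
open Summit.HodgeConjecture.HodgeConjecture.Cruxes.HLiu418.K2LiuLieRayDifferentiability (conjTranspose_exp_mul_J_mul_exp exp_add_smul)
open Summit.HodgeConjecture.HodgeConjecture.Cruxes.HLiu418.K2LiuArchScalarSectionCurveDerivative (exp_zero_smul_eq_one)
open Summit.HodgeConjecture.HodgeConjecture.Cruxes.HLiu418.K2LiuArchIntertwiningLieDerivative (continuous_of_entry_hasDerivAt)
open Summit.HodgeConjecture.HodgeConjecture.Cruxes.HLiu418.K2LiuArchIntertwiningLieDerivativeExp (hasDerivAt_exp_smul_entry_at)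
open Summit.HodgeConjecture.HodgeConjecture.Cruxes.HLiu418.K2LiuArchIntertwiningDominatedSwap
open Summit.HodgeConjecture.HodgeConjecture.Cruxes.HLiu418.K2LiuArchKFiniteSectionMajorised

/-! ## §1  The ray derivative of a Siegel section along `exp(tX)` -/

/-- **THE RAY DERIVATIVE IS AGAIN A SIEGEL SECTION**: `D_X F := y ↦ d∕dt|₀ F(y exp(tX))` satisfies the parabolic law of `I_w(s, χ)` (the law is a LEFT condition; `deriv` of
a constant multiple, Mathlib `deriv_const_mul_field`). [Knapp1986, Ch. VII §1] -/
theorem isArchSiegelSection_rayDeriv {χ : ℂ → ℂ} {s : ℂ} {F : Matrix (Fin 2 ⊕ Fin 2) (Fin 2 ⊕ Fin 2) ℂ → ℂ} (hF : IsArchSiegelSection χ s F)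
    (X : Matrix (Fin 2 ⊕ Fin 2) (Fin 2 ⊕ Fin 2) ℂ) :
    IsArchSiegelSection χ s (fun y => deriv (fun t : ℝ => F (y * exp (t • X))) 0) := by
  intro p g hp hp21
  have hfun : (fun t : ℝ => F (p * g * exp (t • X))) =
      fun t : ℝ => χ p.toBlocks₁₁.det * (((‖p.toBlocks₁₁.det‖ : ℝ) : ℂ) ^ (2 * s + (Fintype.card (Fin 2) : ℂ))) * F (g * exp (t • X)) := by
    funext t
    rw [Matrix.mul_assoc]
    exact hF p _ hp hp21
  show deriv (fun t : ℝ => F (p * g * exp (t • X))) 0 = _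
  rw [hfun, deriv_const_mul_field]

/-- **DIFFERENTIABILITY ALONG THE RAY AT EVERY POINT OF `U(J)`** from differentiability at the coset section `k_v`: `y = p_y · k_{v(y)}` (★ S2-P A rational Iwasawa) and the
Siegel law move the base point to `k_{v(y)}`. [Knapp1986, Ch. VII §1] -/
theorem differentiableAt_ray {χ : ℂ → ℂ} {s : ℂ} {F : Matrix (Fin 2 ⊕ Fin 2) (Fin 2 ⊕ Fin 2) ℂ → ℂ} (hF : IsArchSiegelSection χ s F)
    (X : Matrix (Fin 2 ⊕ Fin 2) (Fin 2 ⊕ Fin 2) ℂ)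
    (hdiff : ∀ v : Matrix (Fin 2) (Fin 2) ℂ, vᴴ * v = 1 →
      DifferentiableAt ℝ (fun t : ℝ => F (((2 : ℂ)⁻¹ • fromBlocks (1 + v) (-(I • (1 - v))) (I • (1 - v)) (1 + v) : Matrix (Fin 2 ⊕ Fin 2) (Fin 2 ⊕ Fin 2) ℂ) *
        exp (t • X))) 0)
    {y : Matrix (Fin 2 ⊕ Fin 2) (Fin 2 ⊕ Fin 2) ℂ} (hy : yᴴ * Matrix.J (Fin 2) ℂ * y = Matrix.J (Fin 2) ℂ) :
    DifferentiableAt ℝ (fun t : ℝ => F (y * exp (t • X))) 0 := by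
  set V : Matrix (Fin 2) (Fin 2) ℂ := (denom y (-(I • (1 : Matrix (Fin 2) (Fin 2) ℂ))))⁻¹ * denom y (I • (1 : Matrix (Fin 2) (Fin 2) ℂ)) with hV
  have hfac := iwasawa_mul_kU hy
  have hP := iwasawa_mem_UJ hy
  obtain ⟨h21, -⟩ := iwasawa_lower_blocks hy
  have hvu : Vᴴ * V = 1 := conjTranspose_shilov_mul hy
  simp only [← hV] at hfac hP h21
  -- `F(y e^{tX}) = c_p · F(k_v e^{tX})`
  obtain ⟨c, hc⟩ : ∃ c : ℂ, ∀ t : ℝ, F (y * exp (t • X)) =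
      c * F (((2 : ℂ)⁻¹ • fromBlocks (1 + V) (-(I • (1 - V))) (I • (1 - V)) (1 + V) : Matrix (Fin 2 ⊕ Fin 2) (Fin 2 ⊕ Fin 2) ℂ) * exp (t • X)) :=
    ⟨_, fun t => by
      conv_lhs => rw [← hfac, Matrix.mul_assoc]
      exact hF _ _ hP h21⟩
  have hfun : (fun t : ℝ => F (y * exp (t • X))) =
      fun t : ℝ => c * F (((2 : ℂ)⁻¹ • fromBlocks (1 + V) (-(I • (1 - V))) (I • (1 - V)) (1 + V) : Matrix (Fin 2 ⊕ Fin 2) (Fin 2 ⊕ Fin 2) ℂ) * exp (t • X)) :=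
    funext hc
  rw [hfun]
  exact (hdiff V hvu).const_mul c

/-- **THE `hFD` BINDER OF ★ FILE 1 ALONG `γ_t = exp(tX)`, `X ∈ 𝔲(J)`**: `HasDerivAt (t ↦ F(y·exp(tX))) ((D_X F)(y·exp(t₀X))) t₀` for every `y ∈ U(J)` and every `t₀`
(§1 at the point `y·exp(t₀X) ∈ U(J)` and the group law `exp((t₀+τ)X) = exp(t₀X)exp(τX)`). [Knapp1986, Ch. VII §3] -/
theorem hasDerivAt_ray {χ : ℂ → ℂ} {s : ℂ} {F : Matrix (Fin 2 ⊕ Fin 2) (Fin 2 ⊕ Fin 2) ℂ → ℂ} (hF : IsArchSiegelSection χ s F)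
    {X : Matrix (Fin 2 ⊕ Fin 2) (Fin 2 ⊕ Fin 2) ℂ} (hXJ : Xᴴ * Matrix.J (Fin 2) ℂ + Matrix.J (Fin 2) ℂ * X = 0)
    (hdiff : ∀ v : Matrix (Fin 2) (Fin 2) ℂ, vᴴ * v = 1 →
      DifferentiableAt ℝ (fun t : ℝ => F (((2 : ℂ)⁻¹ • fromBlocks (1 + v) (-(I • (1 - v))) (I • (1 - v)) (1 + v) : Matrix (Fin 2 ⊕ Fin 2) (Fin 2 ⊕ Fin 2) ℂ) *
        exp (t • X))) 0)
    {y : Matrix (Fin 2 ⊕ Fin 2) (Fin 2 ⊕ Fin 2) ℂ} (hy : yᴴ * Matrix.J (Fin 2) ℂ * y = Matrix.J (Fin 2) ℂ) (t₀ : ℝ) :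
    HasDerivAt (fun t : ℝ => F (y * exp (t • X))) (deriv (fun t : ℝ => F (y * exp (t₀ • X) * exp (t • X))) 0) t₀ := by
  have hy' : (y * exp (t₀ • X))ᴴ * Matrix.J (Fin 2) ℂ * (y * exp (t₀ • X)) = Matrix.J (Fin 2) ℂ := mul_mem_UJ hy (conjTranspose_exp_mul_J_mul_exp hXJ t₀)
  have h0 := (differentiableAt_ray hF X hdiff hy').hasDerivAt
  have hshift : (fun t : ℝ => F (y * exp (t • X))) = fun t : ℝ => (fun τ : ℝ => F (y * exp (t₀ • X) * exp (τ • X))) (t - t₀) := by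
    funext t
    simp only [Matrix.mul_assoc, ← exp_add_smul, add_sub_cancel]
  rw [hshift]
  exact HasDerivAt.comp_sub_const t₀ t₀ (by rw [sub_self]; exact h0)

/-! ## §2  Real generators `X = C·(α β; γ δ)·C′`: differentiability at `k_u` and the compact picture of `D_X F` -/

/-- differentiability of `t ↦ F(k_u exp(tX))` at `0` for `X = C·(α β; γ δ)·C′ ∈ 𝔲(J)` (★ FILE 1′). [LeeZhu1998, §5] -/
theorem differentiableAt_ray_kU (k : ℤ) (s : ℂ) {F : Matrix (Fin 2 ⊕ Fin 2) (Fin 2 ⊕ Fin 2) ℂ → ℂ}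
    (hF : IsArchSiegelSection (fun z : ℂ => (conj z / ((‖z‖ : ℝ) : ℂ)) ^ k) s F) (Q : Carrier)
    (hFQ : ∀ (v : Matrix (Fin 2) (Fin 2) ℂ), vᴴ * v = 1 → ∀ hv : v.det ≠ 0,
      F ((2 : ℂ)⁻¹ • fromBlocks (1 + v) (-(I • (1 - v))) (I • (1 - v)) (1 + v)) = evalAt v hv Q)
    (α β γ δ : Matrix (Fin 2) (Fin 2) ℂ)
    (hX : (fromBlocks 1 1 (I • 1) (-(I • 1)) * fromBlocks α β γ δ * ((2 : ℂ)⁻¹ • fromBlocks 1 (-(I • 1)) 1 (I • 1)) : Matrix (Fin 2 ⊕ Fin 2) (Fin 2 ⊕ Fin 2) ℂ)ᴴ *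
        Matrix.J (Fin 2) ℂ + Matrix.J (Fin 2) ℂ * (fromBlocks 1 1 (I • 1) (-(I • 1)) * fromBlocks α β γ δ * ((2 : ℂ)⁻¹ • fromBlocks 1 (-(I • 1)) 1 (I • 1))) = 0)
    (v : Matrix (Fin 2) (Fin 2) ℂ) (hv : vᴴ * v = 1) :
    DifferentiableAt ℝ (fun t : ℝ => F (((2 : ℂ)⁻¹ • fromBlocks (1 + v) (-(I • (1 - v))) (I • (1 - v)) (1 + v) : Matrix (Fin 2 ⊕ Fin 2) (Fin 2 ⊕ Fin 2) ℂ) *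
      exp (t • (fromBlocks 1 1 (I • 1) (-(I • 1)) * fromBlocks α β γ δ * ((2 : ℂ)⁻¹ • fromBlocks 1 (-(I • 1)) 1 (I • 1)) : Matrix (Fin 2 ⊕ Fin 2) (Fin 2 ⊕ Fin 2) ℂ)))) 0 := by
  have hv' : v.det ≠ 0 := fun h0 => by
    have h := norm_det_eq_one_of_unitary hv
    rw [h0, norm_zero] at h
    exact zero_ne_one h
  exact (hasDerivAt_section_kU_exp_evalAt' k s hF Q hFQ hv hv' α β γ δ hX).differentiableAt

/-- **THE COMPACT PICTURE OF THE RAY DERIVATIVE IS `Op^{(k,s)}_{(αβγδ)} Q`** (★ FILE 1′ read through `HasDerivAt.deriv`). [LeeZhu1998, §5 p. 5032] [Knapp1986, Ch. VIII §3] -/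
theorem rayDeriv_kU_eq_evalAt_op (k : ℤ) (s : ℂ) {F : Matrix (Fin 2 ⊕ Fin 2) (Fin 2 ⊕ Fin 2) ℂ → ℂ}
    (hF : IsArchSiegelSection (fun z : ℂ => (conj z / ((‖z‖ : ℝ) : ℂ)) ^ k) s F) (Q : Carrier)
    (hFQ : ∀ (v : Matrix (Fin 2) (Fin 2) ℂ), vᴴ * v = 1 → ∀ hv : v.det ≠ 0,
      F ((2 : ℂ)⁻¹ • fromBlocks (1 + v) (-(I • (1 - v))) (I • (1 - v)) (1 + v)) = evalAt v hv Q)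
    (α β γ δ : Matrix (Fin 2) (Fin 2) ℂ)
    (hX : (fromBlocks 1 1 (I • 1) (-(I • 1)) * fromBlocks α β γ δ * ((2 : ℂ)⁻¹ • fromBlocks 1 (-(I • 1)) 1 (I • 1)) : Matrix (Fin 2 ⊕ Fin 2) (Fin 2 ⊕ Fin 2) ℂ)ᴴ *
        Matrix.J (Fin 2) ℂ + Matrix.J (Fin 2) ℂ * (fromBlocks 1 1 (I • 1) (-(I • 1)) * fromBlocks α β γ δ * ((2 : ℂ)⁻¹ • fromBlocks 1 (-(I • 1)) 1 (I • 1))) = 0)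
    (u : Matrix (Fin 2) (Fin 2) ℂ) (hu : uᴴ * u = 1) (hu' : u.det ≠ 0) :
    (fun y : Matrix (Fin 2 ⊕ Fin 2) (Fin 2 ⊕ Fin 2) ℂ => deriv (fun t : ℝ => F (y *
        exp (t • (fromBlocks 1 1 (I • 1) (-(I • 1)) * fromBlocks α β γ δ * ((2 : ℂ)⁻¹ • fromBlocks 1 (-(I • 1)) 1 (I • 1)) : Matrix (Fin 2 ⊕ Fin 2) (Fin 2 ⊕ Fin 2) ℂ)))) 0)
      ((2 : ℂ)⁻¹ • fromBlocks (1 + u) (-(I • (1 - u))) (I • (1 - u)) (1 + u)) =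
      evalAt u hu' (∑ a : Fin 2, ∑ b : Fin 2, β a b • pOp pd uMat dInv (s + 1 + (-(k : ℂ)) / 2) a b Q +
          ∑ a : Fin 2, ∑ b : Fin 2, γ a b • mOp pd uMat (s + 1 - (-(k : ℂ)) / 2) a b Q + ((-(k : ℂ)) * α.trace) • Q -
          ∑ a : Fin 2, ∑ b : Fin 2, α a b • lOp pd uMat a b Q + ∑ a : Fin 2, ∑ b : Fin 2, δ a b • rOp pd uMat a b Q) :=
  (hasDerivAt_section_kU_exp_evalAt' k s hF Q hFQ hu hu' α β γ δ hX).deriv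

/-! ## §3  The swap lemma for every section with a compact picture -/

/-- **THE SWAP LEMMA FOR EVERY `K_w`-FINITE SIEGEL SECTION** (`re s > ½`, `g ∈ U(J)`, `X = C·(α β; γ δ)·C′ ∈ 𝔲(J)`):
`HasDerivAt (t ↦ M_w F (g·exp(tX))) (M_w (D_X F) (g)) 0`, and the derivative integrand is integrable — ★ FILE 1 `integrable_and_hasDerivAt_archIntertwining_of_dominated` with the
binders of ★ FILE 2 for `F` and for `D_X F` (a section with compact picture `Op Q`, §2) and §1's `hFD`.  With `G := y ↦ M_w F (y)`, `D := y ↦ M_w (D_X F) (y)` and `g = k_u` this is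
the binder `hD_j` of ★ (H2-alg) `rung_step`. [Knapp1986, Ch. VII §§3–4] [Shimura1997, §16.4] [LeeZhu1998, §5] -/
theorem integrable_and_hasDerivAt_archIntertwining_rayDeriv (k : ℤ) {s : ℂ} (hs : 1 / 2 < s.re) {F : Matrix (Fin 2 ⊕ Fin 2) (Fin 2 ⊕ Fin 2) ℂ → ℂ}
    (hF : IsArchSiegelSection (fun z : ℂ => (conj z / ((‖z‖ : ℝ) : ℂ)) ^ k) s F) (Q : Carrier)
    (hFQ : ∀ (v : Matrix (Fin 2) (Fin 2) ℂ), vᴴ * v = 1 → ∀ hv : v.det ≠ 0,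
      F ((2 : ℂ)⁻¹ • fromBlocks (1 + v) (-(I • (1 - v))) (I • (1 - v)) (1 + v)) = evalAt v hv Q)
    (α β γ δ : Matrix (Fin 2) (Fin 2) ℂ)
    (hX : (fromBlocks 1 1 (I • 1) (-(I • 1)) * fromBlocks α β γ δ * ((2 : ℂ)⁻¹ • fromBlocks 1 (-(I • 1)) 1 (I • 1)) : Matrix (Fin 2 ⊕ Fin 2) (Fin 2 ⊕ Fin 2) ℂ)ᴴ *
        Matrix.J (Fin 2) ℂ + Matrix.J (Fin 2) ℂ * (fromBlocks 1 1 (I • 1) (-(I • 1)) * fromBlocks α β γ δ * ((2 : ℂ)⁻¹ • fromBlocks 1 (-(I • 1)) 1 (I • 1))) = 0)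
    {g : Matrix (Fin 2 ⊕ Fin 2) (Fin 2 ⊕ Fin 2) ℂ} (hg : gᴴ * Matrix.J (Fin 2) ℂ * g = Matrix.J (Fin 2) ℂ) :
    Integrable (fun r : Fin 2 → Fin 2 → ℝ => (fun y : Matrix (Fin 2 ⊕ Fin 2) (Fin 2 ⊕ Fin 2) ℂ => deriv (fun t : ℝ => F (y *
        exp (t • (fromBlocks 1 1 (I • 1) (-(I • 1)) * fromBlocks α β γ δ * ((2 : ℂ)⁻¹ • fromBlocks 1 (-(I • 1)) 1 (I • 1)) : Matrix (Fin 2 ⊕ Fin 2) (Fin 2 ⊕ Fin 2) ℂ)))) 0)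
        (Matrix.J (Fin 2) ℂ * fromBlocks 1 (hermOfReal r) 0 1 * g)) ∧
      HasDerivAt (fun t : ℝ => archIntertwining F (g *
          exp (t • (fromBlocks 1 1 (I • 1) (-(I • 1)) * fromBlocks α β γ δ * ((2 : ℂ)⁻¹ • fromBlocks 1 (-(I • 1)) 1 (I • 1)) : Matrix (Fin 2 ⊕ Fin 2) (Fin 2 ⊕ Fin 2) ℂ))))
        (archIntertwining (fun y : Matrix (Fin 2 ⊕ Fin 2) (Fin 2 ⊕ Fin 2) ℂ => deriv (fun t : ℝ => F (y *
          exp (t • (fromBlocks 1 1 (I • 1) (-(I • 1)) * fromBlocks α β γ δ * ((2 : ℂ)⁻¹ • fromBlocks 1 (-(I • 1)) 1 (I • 1)) : Matrix (Fin 2 ⊕ Fin 2) (Fin 2 ⊕ Fin 2) ℂ)))) 0) g) 0 := by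
  set X : Matrix (Fin 2 ⊕ Fin 2) (Fin 2 ⊕ Fin 2) ℂ := fromBlocks 1 1 (I • 1) (-(I • 1)) * fromBlocks α β γ δ * ((2 : ℂ)⁻¹ • fromBlocks 1 (-(I • 1)) 1 (I • 1)) with hXdef
  -- the ray derivative is a section with compact picture `Op Q`
  have hD : IsArchSiegelSection (fun z : ℂ => (conj z / ((‖z‖ : ℝ) : ℂ)) ^ k) s (fun y => deriv (fun t : ℝ => F (y * exp (t • X))) 0) :=
    isArchSiegelSection_rayDeriv hF X
  have hDQ : ∀ (u : Matrix (Fin 2) (Fin 2) ℂ), uᴴ * u = 1 → ∀ hu : u.det ≠ 0,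
      (fun y => deriv (fun t : ℝ => F (y * exp (t • X))) 0) ((2 : ℂ)⁻¹ • fromBlocks (1 + u) (-(I • (1 - u))) (I • (1 - u)) (1 + u)) = evalAt u hu _ :=
    fun u hu hu' => rayDeriv_kU_eq_evalAt_op k s hF Q hFQ α β γ δ hX u hu hu'
  -- the binders of ★ FILE 1
  obtain ⟨CF, -, hFb⟩ := exists_norm_apply_le k s hF Q hFQ
  obtain ⟨CD, hCD, hDb⟩ := exists_norm_apply_le k s hD _ hDQ
  have hFc := continuousOn_UJ k s hF Q hFQ
  have hDc := continuousOn_UJ k s hD _ hDQ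
  have hdiff := differentiableAt_ray_kU k s hF Q hFQ α β γ δ hX
  have hFD : ∀ y : Matrix (Fin 2 ⊕ Fin 2) (Fin 2 ⊕ Fin 2) ℂ, yᴴ * Matrix.J (Fin 2) ℂ * y = Matrix.J (Fin 2) ℂ →
      ∀ t : ℝ, HasDerivAt (fun t : ℝ => F (y * exp (t • X))) ((fun y => deriv (fun t : ℝ => F (y * exp (t • X))) 0) (y * exp (t • X))) t :=
    fun y hy t₀ => hasDerivAt_ray hF hX hdiff hy t₀
  exact integrable_and_hasDerivAt_archIntertwining_of_dominated hs hg (exp_zero_smul_eq_one X)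
    (continuous_of_entry_hasDerivAt (γ' := fun t => X * exp (t • X)) (hasDerivAt_exp_smul_entry_at X)) (conjTranspose_exp_mul_J_mul_exp hX)
    F _ hFc hDc hCD hFb hDb hFD

end Summit.HodgeConjecture.HodgeConjecture.Cruxes.HLiu418.K2LiuArchIntertwiningKFiniteSwap

end
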